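import Summits.QuantumFields.QCD.Theorems.PauliWegnerSeaFMClosureUnquenchedTwoStarC1Aux3
import Summits.QuantumFields.QCD.Theorems.PauliWegnerSeaFMClosureUnquenchedTwoStarC1Aux4

/-!
# Crux `FMClosureUnquenched` (stmt-QuantumFields-11512), line `von-mises-circles`, stub `stub_twoStar` —
helper 5: the a-priori fractional-moment bound on a two-star fibre (ASFH Lemma 4) and clause (T5)

Fix the constants `s₁, C₁, p₁` of `FibreBandLaw` at `n = 32` links and degree `d = 4 N_f + 4` (hypothesis `hB`,
the band law's body verbatim) and the constant `C₀` of K1♭ transported to super-fibres of the two stars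
(hypothesis `hC`, helper 2).  On every fibre of free links `R ⊇ star(a) ∪ star(b)` (`#R ≤ 32`, outside frozen to
`U`), for an admissible side `A ∋ a, b` and `0 < t ≤ s₁`:

  `∫ e^{-βS} |det 𝔇| ‖G_A(a,b)‖₁^t d(Haar on R) ≤ C₀^t C₁ (1+|β|)^{p₁} ∫ e^{-βS} |det 𝔇| d(Haar on R)`

(`fibre_T5`): by Cramer `‖G_A(a,b)‖₁^t = ‖adj_{ab}‖₁^t |det D_A|^{-t}`, K1♭ bounds `‖adj_{ab}‖₁` by `C₀ sup_fibre |det D_A|`,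
and the negative-moment clause (Neg) of the band law for `Q = det (D_A ⊕ 1)` under the tilt `P = det 𝔇` bounds
`∫ |det D_A|^{-t} wt / Z` by `C₁(1+|β|)^{p₁} (sup_fibre |det D_A|)^{-t}` — the suprema cancel.  Integrating over the
outside (helper 3) gives clause (T5) of `TwoStarBounds` and its side-matrix generalisation with integrability
(`T5_general`, `T5_inv`).

References: Aizenman–Schenker–Friedrich–Hundertmark, CMP 224 (2001) 219, Lemma 4 and App. A [AizenmanEtAl2001].
-/

noncomputable section

open scoped BigOperators ENNReal
open MeasureTheory
open Literature.MathematicalPhysics.QuantumFieldTheory Literature.MathematicalPhysics.QuantumLattice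
  Literature.Probability.LatticeModels
open Summit.QuantumFields.QCD.Theorems.VonMisesCircles

namespace Summit.QuantumFields.QCD.Theorems.VonMisesCirclesC1

/-! ## Elementary inequalities -/

/-- AM–GM with a parameter: `2FG ≤ λ F² + λ⁻¹ G²` (`λ > 0`). [folklore] -/
theorem two_mul_mul_le_param (F G lam : ℝ) (hlam : 0 < lam) : 2 * F * G ≤ lam * F ^ 2 + lam⁻¹ * G ^ 2 := by
  have h : lam * F ^ 2 + lam⁻¹ * G ^ 2 - 2 * F * G = (lam * F - G) ^ 2 / lam := by
    field_simp
    ring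
  have h2 : 0 ≤ (lam * F - G) ^ 2 / lam := div_nonneg (sq_nonneg _) hlam.le
  linarith

/-- For `0 < s ≤ 1` and `0 ≤ x ≤ σ`: `σ^{s-1} x ≤ x^s`. [folklore] -/
theorem rpow_sub_one_mul_le_rpow (x σ s : ℝ) (hs : 0 < s) (hs1 : s ≤ 1) (hx : 0 ≤ x) (hxσ : x ≤ σ) :
    σ ^ (s - 1) * x ≤ x ^ s := by
  rcases hx.lt_or_eq with hx0 | hx0
  · have h1 : σ ^ (s - 1) ≤ x ^ (s - 1) := Real.rpow_le_rpow_of_nonpos hx0 hxσ (by linarith)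
    calc σ ^ (s - 1) * x ≤ x ^ (s - 1) * x := mul_le_mul_of_nonneg_right h1 hx
      _ = x ^ s := by rw [Real.rpow_sub_one hx0.ne', div_mul_cancel₀ _ hx0.ne']
  · subst hx0
    rw [mul_zero, Real.zero_rpow hs.ne']

/-- `(x^a)^2 = x^{2a}` for `x ≥ 0`. [folklore] -/
theorem rpow_sq_eq (x a : ℝ) (hx : 0 ≤ x) : (x ^ a) ^ 2 = x ^ (2 * a) := by
  rw [← Real.rpow_natCast, ← Real.rpow_mul hx]
  norm_num [mul_comm]

/-- `(x^{-a})^2 = x^{-2a}` for `x ≥ 0`. [folklore] -/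
theorem rpow_neg_sq_eq (x a : ℝ) (hx : 0 ≤ x) : (x ^ (-a)) ^ 2 = x ^ (-(2 * a)) := by
  rw [rpow_sq_eq x (-a) hx]
  ring_nf

section TwoStar

variable {Nf : ℕ} {s₁ C₁ p₁ C₀ m₀ : ℝ}

/-- The un-normalised fibre weight `e^{-βS}|det 𝔇|` is bounded, hence integrable against product Haar composed
with any refit. [folklore] -/
theorem integrable_weight_refit {S : ℕ} (β : ℝ) (mq : Fin Nf → ℝ) (R : Finset (Edge 4 (2 * S + 1)))
    (U : GaugeConfig 4 (2 * S + 1) (Matrix.specialUnitaryGroup (Fin 3) ℂ)) :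
    Integrable (fun W : GaugeConfig 4 (2 * S + 1) (Matrix.specialUnitaryGroup (Fin 3) ℂ) =>
      Real.exp (-(β * wilsonAction (fundamentalRep (Fin 3)) (fun e => if e ∈ R then W e else U e))) *
        ‖(diracMatrix (fun e => if e ∈ R then W e else U e) mq).det‖)
      (Measure.pi fun _ : Edge 4 (2 * S + 1) => haarProbability (Matrix.specialUnitaryGroup (Fin 3) ℂ)) := by
  obtain ⟨B, hB⟩ := exists_abs_wilsonAction_le (d := 4) (L := 2 * S + 1) (fundamentalRep (Fin 3))
    (continuous_fundamentalRep (Fin 3))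
  obtain ⟨Cd, hCd⟩ := exists_norm_det_diracMatrix_le (S := 2 * S + 1) mq
  have hSm := measurable_wilsonAction (d := 4) (L := 2 * S + 1) (fundamentalRep (Fin 3))
    (continuous_fundamentalRep (Fin 3))
  have hdm := measurable_norm_det_diracMatrix (S := 2 * S + 1) mq
  have hT := measurable_refit R U
  refine Integrable.of_bound
    (((Real.measurable_exp.comp ((hSm.comp hT).const_mul β).neg).mul (hdm.comp hT)).aestronglyMeasurable)
    (Real.exp (|β| * B) * Cd) (ae_of_all _ fun W => ?_)
  rw [Real.norm_eq_abs, abs_mul, abs_of_nonneg (Real.exp_pos _).le, abs_of_nonneg (norm_nonneg _)]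
  refine mul_le_mul (Real.exp_le_exp.2 ?_) (hCd _) (norm_nonneg _) (Real.exp_pos _).le
  have h1 := hB (fun e => if e ∈ R then W e else U e)
  have h2 : |β * wilsonAction (fundamentalRep (Fin 3)) (fun e => if e ∈ R then W e else U e)| ≤ |β| * B := by
    rw [abs_mul]; exact mul_le_mul_of_nonneg_left h1 (abs_nonneg _)
  exact (neg_le_abs _).trans h2

variable (hB : ∀ (N : ℕ) [NeZero N] (R : Finset (Edge 4 N)), R.card ≤ 32 →
    ∀ (U : GaugeConfig 4 N (Matrix.specialUnitaryGroup (Fin 3) ℂ)) (β : ℝ)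
      (P Q : GaugeConfig 4 N (Matrix.specialUnitaryGroup (Fin 3) ℂ) → ℂ),
      IsFibrePoly (4 * Nf + 4) P → IsFibrePoly (4 * Nf + 4) Q →
      let refit : GaugeConfig 4 N (Matrix.specialUnitaryGroup (Fin 3) ℂ) →
          GaugeConfig 4 N (Matrix.specialUnitaryGroup (Fin 3) ℂ) := fun W e => if e ∈ R then W e else U e
      let wt : GaugeConfig 4 N (Matrix.specialUnitaryGroup (Fin 3) ℂ) → ℝ := fun W =>
        Real.exp (-(β * wilsonAction (fundamentalRep (Fin 3)) (refit W))) * ‖P (refit W)‖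
      let haar : Measure (GaugeConfig 4 N (Matrix.specialUnitaryGroup (Fin 3) ℂ)) :=
        Measure.pi fun _ => haarProbability (Matrix.specialUnitaryGroup (Fin 3) ℂ)
      let Z : ℝ := ∫ W, wt W ∂haar
      (∃ W, P (refit W) ≠ 0) →
        ((∃ W, Q (refit W) ≠ 0) → ∀ᵐ W ∂haar, Q (refit W) ≠ 0) ∧
        (∀ W₀ : GaugeConfig 4 N (Matrix.specialUnitaryGroup (Fin 3) ℂ),
          ‖Q (refit W₀)‖ ≤ C₁ * (1 + |β|) ^ p₁ * ((∫ W, ‖Q (refit W)‖ * wt W ∂haar) / Z)) ∧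
        (∀ s : ℝ, 0 < s → s ≤ s₁ →
          Integrable (fun W => ‖Q (refit W)‖ ^ (-s) * wt W) haar ∧
          (∫ W, ‖Q (refit W)‖ ^ (-s) * wt W ∂haar) / Z ≤
            C₁ * (1 + |β|) ^ p₁ *
              (⨆ W : GaugeConfig 4 N (Matrix.specialUnitaryGroup (Fin 3) ℂ), ‖Q (refit W)‖) ^ (-s)))
  (hC₁ : 0 < C₁) (hC₀ : 0 < C₀)
  (hC : ∀ (S : ℕ) (A : Finset (TorusSite 4 (2 * S + 1))), AdmissibleSide S A →
      ∀ (x y : TorusSite 4 (2 * S + 1)), x ∈ A → y ∈ A →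
      ∀ (R : Finset (Edge 4 (2 * S + 1))),
        (∀ e : Edge 4 (2 * S + 1),
          (e.1 = x ∨ Site.shift e.1 e.2 = x ∨ e.1 = y ∨ Site.shift e.1 e.2 = y) → e ∈ R) →
      ∀ (U W : GaugeConfig 4 (2 * S + 1) (Matrix.specialUnitaryGroup (Fin 3) ℂ)),
        blockNorm ((sideMatrix A (wilsonD (fun e => if e ∈ R then W e else U e) m₀)).adjugate) x y ≤
          C₀ * ⨆ W' : GaugeConfig 4 (2 * S + 1) (Matrix.specialUnitaryGroup (Fin 3) ℂ),
            ‖(sideMatrix A (wilsonD (fun e => if e ∈ R then W' e else U e) m₀)).det‖)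

include hB hC₁ hC₀ hC

/-- **ASFH Lemma 4 on a super-fibre of the two stars.**  For an admissible side `A ∋ a, b`, free links
`R ⊇ star(a) ∪ star(b)` with `#R ≤ 32`, `0 < t ≤ s₁` and every outside field `U`:
`∫ e^{-βS}|det 𝔇| ‖G_A(a,b)‖₁^t ≤ C₀^t C₁(1+|β|)^{p₁} ∫ e^{-βS}|det 𝔇|` over the fibre. [folklore] -/
theorem fibre_T5 {S : ℕ} (β : ℝ) (mq : Fin Nf → ℝ) (A : Finset (TorusSite 4 (2 * S + 1)))
    (hA : AdmissibleSide S A) (a b : TorusSite 4 (2 * S + 1)) (ha : a ∈ A) (hb : b ∈ A)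
    (R : Finset (Edge 4 (2 * S + 1))) (hRcard : R.card ≤ 32)
    (hR : ∀ e : Edge 4 (2 * S + 1),
      (e.1 = a ∨ Site.shift e.1 e.2 = a ∨ e.1 = b ∨ Site.shift e.1 e.2 = b) → e ∈ R)
    (t : ℝ) (ht : 0 < t) (hts : t ≤ s₁) (U : GaugeConfig 4 (2 * S + 1) (Matrix.specialUnitaryGroup (Fin 3) ℂ)) :
    ∫⁻ W, ENNReal.ofReal (Real.exp (-(β * wilsonAction (fundamentalRep (Fin 3))
          (fun e => if e ∈ R then W e else U e))) *
        ‖(diracMatrix (fun e => if e ∈ R then W e else U e) mq).det‖ *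
        blockNorm (gside A (wilsonD (fun e => if e ∈ R then W e else U e) m₀)) a b ^ t)
      ∂(Measure.pi fun _ : Edge 4 (2 * S + 1) => haarProbability (Matrix.specialUnitaryGroup (Fin 3) ℂ)) ≤
    ENNReal.ofReal (C₀ ^ t * (C₁ * (1 + |β|) ^ p₁)) *
      ∫⁻ W, ENNReal.ofReal (Real.exp (-(β * wilsonAction (fundamentalRep (Fin 3))
          (fun e => if e ∈ R then W e else U e))) *
        ‖(diracMatrix (fun e => if e ∈ R then W e else U e) mq).det‖)
      ∂(Measure.pi fun _ : Edge 4 (2 * S + 1) => haarProbability (Matrix.specialUnitaryGroup (Fin 3) ℂ)) := by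
  -- abbreviations
  set T : GaugeConfig 4 (2 * S + 1) (Matrix.specialUnitaryGroup (Fin 3) ℂ) →
      GaugeConfig 4 (2 * S + 1) (Matrix.specialUnitaryGroup (Fin 3) ℂ) := fun W e => if e ∈ R then W e else U e
    with hTdef
  set haar : Measure (GaugeConfig 4 (2 * S + 1) (Matrix.specialUnitaryGroup (Fin 3) ℂ)) :=
    Measure.pi fun _ => haarProbability (Matrix.specialUnitaryGroup (Fin 3) ℂ) with hhaar
  set P : GaugeConfig 4 (2 * S + 1) (Matrix.specialUnitaryGroup (Fin 3) ℂ) → ℂ := fun V => (diracMatrix V mq).det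
    with hPdef
  set Q : GaugeConfig 4 (2 * S + 1) (Matrix.specialUnitaryGroup (Fin 3) ℂ) → ℂ := fun V =>
    (sideMatrix A (wilsonD V m₀)).det with hQdef
  set wt : GaugeConfig 4 (2 * S + 1) (Matrix.specialUnitaryGroup (Fin 3) ℂ) → ℝ := fun W =>
    Real.exp (-(β * wilsonAction (fundamentalRep (Fin 3)) (T W))) * ‖P (T W)‖ with hwtdef
  have hTm : Measurable T := measurable_refit R U
  have hTc : Continuous T := continuous_refit R U
  have hP : IsFibrePoly (4 * Nf + 4) P := fibrePoly_mono (isFibrePoly_det_diracMatrix mq) (by omega)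
  have hQ : IsFibrePoly (4 * Nf + 4) Q := fibrePoly_mono (isFibrePoly_sideDet A m₀) (by omega)
  have hwt0 : ∀ W, 0 ≤ wt W := fun W => mul_nonneg (Real.exp_pos _).le (norm_nonneg _)
  have hwti : Integrable wt haar := integrable_weight_refit β mq R U
  have hSm := measurable_wilsonAction (d := 4) (L := 2 * S + 1) (fundamentalRep (Fin 3))
    (continuous_fundamentalRep (Fin 3))
  have hwtm : Measurable wt :=
    (Real.measurable_exp.comp ((hSm.comp hTm).const_mul β).neg).mul (hP.1.measurable.comp hTm).norm
  -- the goal in the abbreviations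
  change ∫⁻ W, ENNReal.ofReal (wt W * blockNorm (gside A (wilsonD (T W) m₀)) a b ^ t) ∂haar ≤
    ENNReal.ofReal (C₀ ^ t * (C₁ * (1 + |β|) ^ p₁)) * ∫⁻ W, ENNReal.ofReal (wt W) ∂haar
  -- degenerate fibre: the tilt vanishes identically
  by_cases hPex : ∃ W, P (T W) ≠ 0
  swap
  · push Not at hPex
    have h0 : ∀ W, wt W = 0 := fun W => by rw [hwtdef]; simp [hPex W]
    calc ∫⁻ W, ENNReal.ofReal (wt W * blockNorm (gside A (wilsonD (T W) m₀)) a b ^ t) ∂haar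
        = ∫⁻ _W, 0 ∂haar := lintegral_congr fun W => by rw [h0 W, zero_mul, ENNReal.ofReal_zero]
      _ ≤ _ := by rw [lintegral_zero]; exact bot_le
  -- the supremum of `|det D_A|` over the fibre
  have hQc : Continuous fun W => ‖Q (T W)‖ := (hQ.1.comp hTc).norm
  have hbdd : BddAbove (Set.range fun W => ‖Q (T W)‖) := (isCompact_range hQc).bddAbove
  set M : ℝ := ⨆ W, ‖Q (T W)‖ with hMdef
  have hM0 : 0 ≤ M := Real.iSup_nonneg fun W => norm_nonneg _
  have hleM : ∀ W, ‖Q (T W)‖ ≤ M := fun W => le_ciSup hbdd W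
  rcases hM0.lt_or_eq with hMpos | hM0'
  swap
  · -- `det D_A ≡ 0` on the fibre: the Green function is the junk `0`
    have hdet : ∀ W, (sideMatrix A (wilsonD (T W) m₀)).det = 0 := fun W =>
      norm_eq_zero.1 (le_antisymm (hM0' ▸ hleM W) (norm_nonneg _))
    have h0 : ∀ W, blockNorm (gside A (wilsonD (T W) m₀)) a b ^ t = 0 := fun W => by
      rw [gside, blockNorm_inv_of_det_eq_zero _ _ _ (hdet W), Real.zero_rpow ht.ne']
    calc ∫⁻ W, ENNReal.ofReal (wt W * blockNorm (gside A (wilsonD (T W) m₀)) a b ^ t) ∂haar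
        = ∫⁻ _W, 0 ∂haar := lintegral_congr fun W => by rw [h0 W, mul_zero, ENNReal.ofReal_zero]
      _ ≤ _ := by rw [lintegral_zero]; exact bot_le
  -- (Neg) for `Q = det (D_A ⊕ 1)` at exponent `t`
  have hNeg : Integrable (fun W => ‖Q (T W)‖ ^ (-t) * wt W) haar ∧
      (∫ W, ‖Q (T W)‖ ^ (-t) * wt W ∂haar) / (∫ W, wt W ∂haar) ≤ C₁ * (1 + |β|) ^ p₁ * M ^ (-t) :=
    (hB (2 * S + 1) R hRcard U β P Q hP hQ hPex).2.2 t ht hts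
  -- pointwise: Cramer + K1♭
  have hpt : ∀ W, wt W * blockNorm (gside A (wilsonD (T W) m₀)) a b ^ t ≤
      (C₀ * M) ^ t * (‖Q (T W)‖ ^ (-t) * wt W) := by
    intro W
    rw [gside, blockNorm_inv_rpow]
    have hadj : blockNorm (sideMatrix A (wilsonD (T W) m₀)).adjugate a b ≤ C₀ * M :=
      hC S A hA a b ha hb R hR U W
    have h1 : blockNorm (sideMatrix A (wilsonD (T W) m₀)).adjugate a b ^ t ≤ (C₀ * M) ^ t :=
      Real.rpow_le_rpow (blockNorm_nonneg _ _ _) hadj ht.le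
    have h2 : 0 ≤ ‖(sideMatrix A (wilsonD (T W) m₀)).det‖ ^ (-t) := Real.rpow_nonneg (norm_nonneg _) _
    calc wt W * (blockNorm (sideMatrix A (wilsonD (T W) m₀)).adjugate a b ^ t *
          ‖(sideMatrix A (wilsonD (T W) m₀)).det‖ ^ (-t))
        ≤ wt W * ((C₀ * M) ^ t * ‖(sideMatrix A (wilsonD (T W) m₀)).det‖ ^ (-t)) :=
          mul_le_mul_of_nonneg_left (mul_le_mul_of_nonneg_right h1 h2) (hwt0 W)
      _ = (C₀ * M) ^ t * (‖Q (T W)‖ ^ (-t) * wt W) := by rw [hQdef]; ring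
  have hCM : 0 ≤ (C₀ * M) ^ t := Real.rpow_nonneg (mul_nonneg hC₀.le hM0) _
  have hmeas : Measurable fun W => ENNReal.ofReal (‖Q (T W)‖ ^ (-t) * wt W) :=
    ((hQc.measurable.pow_const _).mul hwtm).ennreal_ofReal
  have hB0 : 0 ≤ C₁ * (1 + |β|) ^ p₁ * M ^ (-t) :=
    mul_nonneg (mul_nonneg hC₁.le (Real.rpow_nonneg (by positivity) _)) (Real.rpow_nonneg hM0 _)
  have hkey := lintegral_ofReal_mul_le_of_div_le haar hwt0 (fun W => Real.rpow_nonneg (norm_nonneg _) _)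
    hwti hNeg.1 hB0 hNeg.2
  calc ∫⁻ W, ENNReal.ofReal (wt W * blockNorm (gside A (wilsonD (T W) m₀)) a b ^ t) ∂haar
      ≤ ∫⁻ W, ENNReal.ofReal ((C₀ * M) ^ t) * ENNReal.ofReal (‖Q (T W)‖ ^ (-t) * wt W) ∂haar := by
        refine lintegral_mono fun W => ?_
        rw [← ENNReal.ofReal_mul hCM]
        exact ENNReal.ofReal_le_ofReal (hpt W)
    _ = ENNReal.ofReal ((C₀ * M) ^ t) * ∫⁻ W, ENNReal.ofReal (‖Q (T W)‖ ^ (-t) * wt W) ∂haar :=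
        lintegral_const_mul _ hmeas
    _ ≤ ENNReal.ofReal ((C₀ * M) ^ t) * (ENNReal.ofReal (C₁ * (1 + |β|) ^ p₁ * M ^ (-t)) *
          ∫⁻ W, ENNReal.ofReal (wt W) ∂haar) := by
        gcongr
    _ = ENNReal.ofReal (C₀ ^ t * (C₁ * (1 + |β|) ^ p₁)) * ∫⁻ W, ENNReal.ofReal (wt W) ∂haar := by
        rw [← mul_assoc, ← ENNReal.ofReal_mul hCM]
        congr 2
        have hMt : M ^ t ≠ 0 := (Real.rpow_pos_of_pos hMpos t).ne'
        rw [Real.mul_rpow hC₀.le hM0, Real.rpow_neg hM0]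
        field_simp

/-- `fibre_T5` for the full Green function `D⁻¹` (`A = univ`). [folklore] -/
theorem fibre_T5_inv {S : ℕ} (β : ℝ) (mq : Fin Nf → ℝ) (a b : TorusSite 4 (2 * S + 1))
    (R : Finset (Edge 4 (2 * S + 1))) (hRcard : R.card ≤ 32)
    (hR : ∀ e : Edge 4 (2 * S + 1),
      (e.1 = a ∨ Site.shift e.1 e.2 = a ∨ e.1 = b ∨ Site.shift e.1 e.2 = b) → e ∈ R)
    (t : ℝ) (ht : 0 < t) (hts : t ≤ s₁) (U : GaugeConfig 4 (2 * S + 1) (Matrix.specialUnitaryGroup (Fin 3) ℂ)) :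
    ∫⁻ W, ENNReal.ofReal (Real.exp (-(β * wilsonAction (fundamentalRep (Fin 3))
          (fun e => if e ∈ R then W e else U e))) *
        ‖(diracMatrix (fun e => if e ∈ R then W e else U e) mq).det‖ *
        blockNorm (wilsonD (fun e => if e ∈ R then W e else U e) m₀)⁻¹ a b ^ t)
      ∂(Measure.pi fun _ : Edge 4 (2 * S + 1) => haarProbability (Matrix.specialUnitaryGroup (Fin 3) ℂ)) ≤
    ENNReal.ofReal (C₀ ^ t * (C₁ * (1 + |β|) ^ p₁)) *
      ∫⁻ W, ENNReal.ofReal (Real.exp (-(β * wilsonAction (fundamentalRep (Fin 3))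
          (fun e => if e ∈ R then W e else U e))) *
        ‖(diracMatrix (fun e => if e ∈ R then W e else U e) mq).det‖)
      ∂(Measure.pi fun _ : Edge 4 (2 * S + 1) => haarProbability (Matrix.specialUnitaryGroup (Fin 3) ℂ)) := by
  have h := fibre_T5 hB hC₁ hC₀ hC β mq Finset.univ (Or.inl rfl) a b (Finset.mem_univ _) (Finset.mem_univ _)
    R hRcard hR t ht hts U
  simp_rw [gside_univ] at h
  exact h

/-- **Clause (T5), side-matrix form, with integrability.**  For an admissible side `A ∋ a, b` and `0 < t ≤ s₁`:
`pqE[‖G_A(a,b)‖₁^t] ≤ C₀^t C₁ (1+|β|)^{p₁}` and `|det 𝔇| ‖G_A(a,b)‖₁^t` is `μ_W`-integrable. [folklore] -/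
theorem T5_general {S : ℕ} (β : ℝ) (mq : Fin Nf → ℝ) (A : Finset (TorusSite 4 (2 * S + 1)))
    (hA : AdmissibleSide S A) (a b : TorusSite 4 (2 * S + 1)) (ha : a ∈ A) (hb : b ∈ A)
    (t : ℝ) (ht : 0 < t) (hts : t ≤ s₁) :
    pqE Nf S β mq (fun U => blockNorm (gside A (wilsonD U m₀)) a b ^ t) ≤ C₀ ^ t * (C₁ * (1 + |β|) ^ p₁) ∧
      Integrable (fun U => ‖(diracMatrix U mq).det‖ * blockNorm (gside A (wilsonD U m₀)) a b ^ t)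
        (wilsonMeasure (d := 4) (L := 2 * S + 1) (fundamentalRep (Fin 3)) β) := by
  set R : Finset (Edge 4 (2 * S + 1)) := Finset.univ.filter fun e : Edge 4 (2 * S + 1) =>
    e.1 = a ∨ Site.shift e.1 e.2 = a ∨ e.1 = b ∨ Site.shift e.1 e.2 = b with hRdef
  have hRcard : R.card ≤ 32 := (card_filter_twoStar_le a b).trans (by norm_num)
  have hR : ∀ e : Edge 4 (2 * S + 1),
      (e.1 = a ∨ Site.shift e.1 e.2 = a ∨ e.1 = b ∨ Site.shift e.1 e.2 = b) → e ∈ R := fun e he =>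
    Finset.mem_filter.2 ⟨Finset.mem_univ _, he⟩
  exact pqE_le_of_fibre_bound β mq _ (fun U => Real.rpow_nonneg (blockNorm_nonneg _ _ _) _)
    ((measurable_blockNorm_gside A m₀ a b).pow_const t)
    (mul_nonneg (Real.rpow_nonneg hC₀.le _) (mul_nonneg hC₁.le (Real.rpow_nonneg (by positivity) _))) R
    fun U => fibre_T5 hB hC₁ hC₀ hC β mq A hA a b ha hb R hRcard hR t ht hts U

/-- **Clause (T5) of `TwoStarBounds`** (`A = univ`): `pqE[‖D⁻¹(x,y)‖₁^t] ≤ C₀^t C₁ (1+|β|)^{p₁}` for `0 < t ≤ s₁`,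
uniformly in the volume, with integrability. [folklore] -/
theorem T5_inv {S : ℕ} (β : ℝ) (mq : Fin Nf → ℝ) (x y : TorusSite 4 (2 * S + 1))
    (t : ℝ) (ht : 0 < t) (hts : t ≤ s₁) :
    pqE Nf S β mq (fun U => blockNorm (wilsonD U m₀)⁻¹ x y ^ t) ≤ C₀ ^ t * (C₁ * (1 + |β|) ^ p₁) ∧
      Integrable (fun U => ‖(diracMatrix U mq).det‖ * blockNorm (wilsonD U m₀)⁻¹ x y ^ t)
        (wilsonMeasure (d := 4) (L := 2 * S + 1) (fundamentalRep (Fin 3)) β) := by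
  have h := T5_general hB hC₁ hC₀ hC β mq Finset.univ (Or.inl rfl) x y (Finset.mem_univ _) (Finset.mem_univ _)
    t ht hts
  simp_rw [gside_univ] at h
  exact h

/-! ## Clause (T0): integrability of products of fractional powers -/

/-- One factor: `|det 𝔇| ‖G_A(a,b)‖₁^t` is `μ_W`-integrable for every admissible `A`, all sites and
`0 ≤ t ≤ s₁` (outside `A × A` the side-wise Green function is bounded by `144`). [folklore] -/
theorem integrable_T0_factor {S : ℕ} (β : ℝ) (mq : Fin Nf → ℝ) (A : Finset (TorusSite 4 (2 * S + 1)))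
    (hA : AdmissibleSide S A) (a b : TorusSite 4 (2 * S + 1)) (t : ℝ) (ht0 : 0 ≤ t) (hts : t ≤ s₁) :
    Integrable (fun U => ‖(diracMatrix U mq).det‖ * blockNorm (gside A (wilsonD U m₀)) a b ^ t)
      (wilsonMeasure (d := 4) (L := 2 * S + 1) (fundamentalRep (Fin 3)) β) := by
  rcases ht0.lt_or_eq with ht | ht
  · by_cases hab : a ∈ A ∧ b ∈ A
    · exact (T5_general hB hC₁ hC₀ hC β mq A hA a b hab.1 hab.2 t ht hts).2
    · have hbd : ∀ U : GaugeConfig 4 (2 * S + 1) (Matrix.specialUnitaryGroup (Fin 3) ℂ),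
          blockNorm (gside A (wilsonD U m₀)) a b ^ t ≤ (144 : ℝ) ^ t := fun U =>
        Real.rpow_le_rpow (blockNorm_nonneg _ _ _) (blockNorm_gside_le_of_not_mem A _ a b (not_and_or.1 hab))
          ht.le
      refine ((integrable_norm_det_diracMatrix mq _).mul_const ((144 : ℝ) ^ t)).mono' ?_ ?_
      · exact ((measurable_norm_det_diracMatrix mq).mul
          ((measurable_blockNorm_gside A m₀ a b).pow_const t)).aestronglyMeasurable
      · refine ae_of_all _ fun U => ?_
        rw [Real.norm_eq_abs, abs_of_nonneg (mul_nonneg (norm_nonneg _)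
          (Real.rpow_nonneg (blockNorm_nonneg _ _ _) _))]
        exact mul_le_mul_of_nonneg_left (hbd U) (norm_nonneg _)
  · subst ht
    simp only [Real.rpow_zero, mul_one]
    exact integrable_norm_det_diracMatrix mq _

omit hB hC₁ hC₀ hC in
/-- `xyz ≤ x³ + y³ + z³` for non-negative reals (AM–GM). [folklore] -/
theorem mul_mul_le_cube_add (x y z : ℝ) (hx : 0 ≤ x) (hy : 0 ≤ y) (hz : 0 ≤ z) :
    x * y * z ≤ x ^ 3 + y ^ 3 + z ^ 3 := by
  nlinarith [mul_nonneg (add_nonneg (add_nonneg hx hy) hz)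
    (add_nonneg (add_nonneg (sq_nonneg (x - y)) (sq_nonneg (y - z))) (sq_nonneg (z - x))),
    mul_nonneg (mul_nonneg hx hy) hz, pow_nonneg hx 3, pow_nonneg hy 3, pow_nonneg hz 3]

omit hB hC₁ hC₀ hC in
/-- `(x^t)^3 = x^{3t}` for `x ≥ 0`. [folklore] -/
theorem rpow_pow_three (x t : ℝ) (hx : 0 ≤ x) : (x ^ t) ^ 3 = x ^ (3 * t) := by
  rw [← Real.rpow_natCast, ← Real.rpow_mul hx]
  norm_num [mul_comm]

/-- **Clause (T0) of `TwoStarBounds`, integrability half**: the (≤ 3)-fold products of fractional powers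
(exponents in `[0, s₁/3]`) of block norms of side-wise Green functions of admissible sides are integrable against
the phase-quenched weight. [folklore] -/
theorem integrable_T0_triple {S : ℕ} (β : ℝ) (mq : Fin Nf → ℝ) (t₁ t₂ t₃ : ℝ)
    (h₁ : 0 ≤ t₁) (h₁' : 3 * t₁ ≤ s₁) (h₂ : 0 ≤ t₂) (h₂' : 3 * t₂ ≤ s₁) (h₃ : 0 ≤ t₃) (h₃' : 3 * t₃ ≤ s₁)
    (A₁ A₂ A₃ : Finset (TorusSite 4 (2 * S + 1)))
    (hA₁ : AdmissibleSide S A₁) (hA₂ : AdmissibleSide S A₂) (hA₃ : AdmissibleSide S A₃)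
    (a₁ b₁ a₂ b₂ a₃ b₃ : TorusSite 4 (2 * S + 1)) :
    Integrable (fun U : GaugeConfig 4 (2 * S + 1) (Matrix.specialUnitaryGroup (Fin 3) ℂ) =>
      ‖(diracMatrix U mq).det‖ *
        (blockNorm (gside A₁ (wilsonD U m₀)) a₁ b₁ ^ t₁ *
          blockNorm (gside A₂ (wilsonD U m₀)) a₂ b₂ ^ t₂ *
          blockNorm (gside A₃ (wilsonD U m₀)) a₃ b₃ ^ t₃))
      (wilsonMeasure (d := 4) (L := 2 * S + 1) (fundamentalRep (Fin 3)) β) := by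
  have g₁ := integrable_T0_factor hB hC₁ hC₀ hC β mq A₁ hA₁ a₁ b₁ (3 * t₁) (by linarith) h₁'
  have g₂ := integrable_T0_factor hB hC₁ hC₀ hC β mq A₂ hA₂ a₂ b₂ (3 * t₂) (by linarith) h₂'
  have g₃ := integrable_T0_factor hB hC₁ hC₀ hC β mq A₃ hA₃ a₃ b₃ (3 * t₃) (by linarith) h₃'
  refine ((g₁.add g₂).add g₃).mono' ?_ (ae_of_all _ fun U => ?_)
  · exact ((measurable_norm_det_diracMatrix mq).mul
      ((((measurable_blockNorm_gside A₁ m₀ a₁ b₁).pow_const t₁).mul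
        ((measurable_blockNorm_gside A₂ m₀ a₂ b₂).pow_const t₂)).mul
        ((measurable_blockNorm_gside A₃ m₀ a₃ b₃).pow_const t₃))).aestronglyMeasurable
  · have hx := Real.rpow_nonneg (blockNorm_nonneg (gside A₁ (wilsonD U m₀)) a₁ b₁) t₁
    have hy := Real.rpow_nonneg (blockNorm_nonneg (gside A₂ (wilsonD U m₀)) a₂ b₂) t₂
    have hz := Real.rpow_nonneg (blockNorm_nonneg (gside A₃ (wilsonD U m₀)) a₃ b₃) t₃
    have hcube := mul_mul_le_cube_add _ _ _ hx hy hz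
    rw [rpow_pow_three _ _ (blockNorm_nonneg _ _ _), rpow_pow_three _ _ (blockNorm_nonneg _ _ _),
      rpow_pow_three _ _ (blockNorm_nonneg _ _ _)] at hcube
    rw [Real.norm_eq_abs, abs_of_nonneg (mul_nonneg (norm_nonneg _) (mul_nonneg (mul_nonneg hx hy) hz))]
    simp only [Pi.add_apply]
    calc ‖(diracMatrix U mq).det‖ *
          (blockNorm (gside A₁ (wilsonD U m₀)) a₁ b₁ ^ t₁ * blockNorm (gside A₂ (wilsonD U m₀)) a₂ b₂ ^ t₂ *
            blockNorm (gside A₃ (wilsonD U m₀)) a₃ b₃ ^ t₃)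
        ≤ ‖(diracMatrix U mq).det‖ *
          (blockNorm (gside A₁ (wilsonD U m₀)) a₁ b₁ ^ (3 * t₁) + blockNorm (gside A₂ (wilsonD U m₀)) a₂ b₂ ^ (3 * t₂) +
            blockNorm (gside A₃ (wilsonD U m₀)) a₃ b₃ ^ (3 * t₃)) :=
          mul_le_mul_of_nonneg_left hcube (norm_nonneg _)
      _ = _ := by ring


end TwoStar

/-- **Registered helper `stub_twoStar_aux5` of crux stmt-QuantumFields-11512** (line `von-mises-circles`, stub
`stub_twoStar`): clause (T5) of `TwoStarBounds` on its own, with integrability — ASFH Lemma 4 from the fibre band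
law and K1♭. [folklore] -/
theorem stub_twoStar_aux5 : FibreBandLaw → LocalCofactorDomination → ∀ (Nf : ℕ), ∃ s₁ K p : ℝ, 0 < s₁ ∧ 0 < K ∧ ∀ (S : ℕ) (β : ℝ) (mq : Fin Nf → ℝ) (f : Fin Nf), -9 ≤ mq f → mq f ≤ 1 → ∀ (x y : TorusSite 4 (2 * S + 1)) (t : ℝ), 0 < t → t ≤ s₁ → pqE Nf S β mq (fun U => blockNorm (wilsonD U (mq f))⁻¹ x y ^ t) ≤ K ^ t * (K * (1 + |β|) ^ p) ∧ Integrable (fun U => ‖(diracMatrix U mq).det‖ * blockNorm (wilsonD U (mq f))⁻¹ x y ^ t) (wilsonMeasure (d := 4) (L := 2 * S + 1) (fundamentalRep (Fin 3)) β) := by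
  intro hFBL hK1 Nf
  obtain ⟨sB, C₁, p₁, hsB, hC₁, hB⟩ := hFBL 32 (4 * Nf + 4)
  obtain ⟨C₀, hC₀, hK⟩ := adj_blockNorm_le_sup_of_localCofactorDomination hK1
  refine ⟨sB, max C₀ C₁, p₁, hsB, lt_max_of_lt_left hC₀, ?_⟩
  intro S β mq f hm₁ hm₂ x y t ht hts
  have h := T5_inv hB hC₁ hC₀ (hK (mq f) hm₁ hm₂) β mq x y t ht hts
  refine ⟨h.1.trans ?_, h.2⟩
  have hB0 : 0 ≤ (1 + |β|) ^ p₁ := Real.rpow_nonneg (by positivity) _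
  exact mul_le_mul (Real.rpow_le_rpow hC₀.le (le_max_left _ _) ht.le)
    (mul_le_mul_of_nonneg_right (le_max_right _ _) hB0) (mul_nonneg hC₁.le hB0)
    (Real.rpow_nonneg (hC₀.le.trans (le_max_left _ _)) _)

end Summit.QuantumFields.QCD.Theorems.VonMisesCirclesC1
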